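import Summits.CriticalPhenomena.PercolationContinuityZ3.Theorems.Transplant.FKThreeApexUCondRimStep
import Summits.CriticalPhenomena.PercolationContinuityZ3.Theorems.Transplant.FKDoubleFanCrossApexRoof
import HarnessLib

/-!
# Double fans `K₂ ∨ P_{m+1}`, cross-apex adjacent pair: the Rayleigh difference is `≥ 0` on `InKE × InKE`

Helper file (`--supports stmt-CriticalPhenomena-4575`), FK sub-lane `prim-bschramm-fk-3` (gen 25); builds on p205010 (kernel theorem, internal
audit signed; external expert review pending).  No named facts, no sorries; standard axioms.  Memo `bschramm/prim-bschramm-fk-3/U-RIM.md` §4–4d.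

Step three of the cross-apex programme.  For the pair `(a c_j, b c_{j+1})` of a double fan the Rayleigh difference of the four pinned
valuations is `q²(1−q)·L(r; u, s)` (`crossL_eq`) with `u, s ∈ InKE q` the prefix and the reversed suffix.  Here: **`L ≥ 0` on
`InKE × InKE`** for `0 < q < 1`, `r ∈ [0,1]` (`InKE.crossL_nonneg`), hence **`InKE.rayleigh_cross_nonneg`** for `0 < q ≤ 1`.
The proof is the ray decomposition of the memo: in the apex-`b` split `u = vecB q W y X Z u₀` the form is linear in `(X, Z, u₀)`
(`crossL_linB`), and `(U_b)(u)` (`InKE.uCondB`) says `u₀ ≤ u₀^roof(X, Z)`, the `U`-tight value at the probe `w ∈ [0,1]` solving the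
direction relation (it exists by the intermediate value theorem); so `u` is a convex combination of the FLOOR point `(X, Z, 0)` and the
ROOF point `(X, Z, u₀^roof)` (`crossL_vecB_nonneg_of_rays`, `crossL_nonneg_of_rays`).  The same on the `s` side through the symmetry `L(u, s) = L(ā(s), ā(u))`
(`ā = swapAB`, `crossL_swap`).  The four ray pairs: floor × floor (`crossL_floor_floor`, explicit), floor × roof and — by the symmetry —
roof × floor (`crossL_floor_pos`, a sum of non-negative terms once `I ≥ 0` on the roof), roof × roof (`crossL_roof_roof_nonneg` of
`…CrossApexRoof`, the core inequality).  The measure-level statement is the sequel (`…DoubleFanSpokesCross`).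
[cite: Grimmett2006, §3.9 eq. (3.94) (pp. 63–64)] [folklore]
-/

noncomputable section

namespace Summit.CriticalPhenomena.PercolationContinuityZ3.Theorems

namespace FK

namespace ThreeApex

/-! ### Symmetry and the easy ray pairs -/

/-- **`u ↔ s` symmetry**: `L(u, s) = L(ā s, ā u)` (reverse the fan and exchange the apices). [folklore] -/
theorem crossL_swap (q r : ℝ) (u s : V5) : crossL q r u s = crossL q r (swapAB s) (swapAB u) := by
  simp only [crossL, crossC, masterN, swapAB, swapBC, conv, kap, jA, hx, hy, hz, V5.total]; ring

/-- `N(w) = (1−q) + qw(1−w) > 0` for `q < 1`, `w ∈ [0,1]`. [folklore] -/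
theorem probeN_pos {q w : ℝ} (hq0 : 0 ≤ q) (hq1 : q < 1) (hw0 : 0 ≤ w) (hw1 : w ≤ 1) : 0 < (1 - q) + q * w * (1 - w) := by
  have := sub_nonneg.2 hw1
  have : 0 ≤ q * w * (1 - w) := by positivity
  linarith

/-- A roof point has `N^{(bc)}, N^{(ab)} ≥ 0` and `I_b ≥ 0`. [folklore] -/
theorem roofB_facts {q W y X Z u0 w : ℝ} (hq2 : q < 2) (hq0 : 0 ≤ q) (hX : 0 ≤ X) (hZ : 0 ≤ Z) (hu0 : 0 ≤ u0) (hW : q * y ≤ W)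
    (hw0 : 0 ≤ w) (hw1 : w ≤ 1) (hN : 0 < (1 - q) + q * w * (1 - w))
    (hR : q * (X - Z) * w ^ 2 + 2 * ((1 - q) * X + Z) * w - (2 - q) * Z = 0)
    (hT : (u0 * (W - q * y) - (X + Z) * y) * ((1 - q) + q * w * (1 - w)) = W * (w ^ 2 * X + (1 - w) ^ 2 * Z)) :
    0 ≤ masterN q (swapAB (vecB q W y X Z u0)) ∧ 0 ≤ masterN q (swapBC (vecB q W y X Z u0)) ∧
      0 ≤ u0 * (W - q * y) - (X + Z) * y := by
  have hWq : 0 ≤ W - q * y := sub_nonneg.2 hW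
  have hM : 0 ≤ (X + Z + q * u0) * (W - q * y) := mul_nonneg (by positivity) hWq
  have hw' : 0 ≤ 1 - w := sub_nonneg.2 hw1
  refine ⟨?_, ?_, ?_⟩
  · rw [← mul_nonneg_iff_of_pos_right hN, roofB_nbc hR hT]
    exact mul_nonneg (mul_nonneg hM (pow_nonneg hw0 2)) hN.le
  · rw [← mul_nonneg_iff_of_pos_right hN, roofB_nab hR hT]
    exact mul_nonneg (mul_nonneg hM (pow_nonneg hw' 2)) hN.le
  · have h := roofB_I hR hT
    have h2 : 0 ≤ (X + Z + q * u0) * (W - q * y) * ((1 - q) + q * w * (1 - w)) * (2 * w * (1 - w)) :=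
      mul_nonneg (mul_nonneg hM hN.le) (by positivity)
    rw [← h, mul_assoc] at h2
    have h2q : 0 < 2 - q := by linarith
    exact (mul_nonneg_iff_of_pos_right hN).1 ((mul_nonneg_iff_of_pos_left h2q).1 h2)

/-- **Floor × floor**: `u = (0, X, y, Z, ·)`, `s = (0, X', Y', z, ·)` — explicit. [folklore] -/
theorem crossL_floor_floor {q r W y X Z W' z X' Y' : ℝ} (hq0 : 0 ≤ q) (hq1 : q ≤ 1) (hr0 : 0 ≤ r) (hr1 : r ≤ 1)
    (hX : 0 ≤ X) (hZ : 0 ≤ Z) (hy0 : 0 ≤ y) (hW : q * y ≤ W) (hX' : 0 ≤ X') (hY' : 0 ≤ Y') (hz0 : 0 ≤ z) (hW' : q * z ≤ W') :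
    0 ≤ crossL q r (vecB q W y X Z 0) (swapAB (vecB q W' z X' Y' 0)) := by
  have e : crossL q r (vecB q W y X Z 0) (swapAB (vecB q W' z X' Y' 0)) =
      X * X' * (r * (r + (1 - r) * q) * ((W + (1 - q) * y) * (W' + (1 - q) * z) - y * z)
        + y * z * (((1 - q) * (1 - r) - r) ^ 2 + r * (1 - r)))
      + (1 - r) * (1 - q) * X * y * Y' * (W' + (1 - q) * z) + (1 - r) * (1 - q) * Z * X' * z * (W + (1 - q) * y)
      + Z * Y' * ((1 - r) * ((W + (1 - q) * y) * (W' + (1 - q) * z)) + r * (r + (1 - r) * q) * (1 - q) * (y * z)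
        + (1 - q) * (2 - q) * (r * (1 - r)) * (y * z)) := by
    simp only [crossL, crossC, vecB, masterN, swapAB, swapBC, conv, kap, jA, hx, hy, hz, V5.total]; ring
  rw [e]
  have hq' := sub_nonneg.2 hq1
  have hr' := sub_nonneg.2 hr1
  have h2q : 0 ≤ 2 - q := by linarith
  have hv : y ≤ W + (1 - q) * y := by linarith
  have hv' : z ≤ W' + (1 - q) * z := by linarith
  have hv0 : 0 ≤ W + (1 - q) * y := hy0.trans hv
  have hv0' : 0 ≤ W' + (1 - q) * z := hz0.trans hv'
  have hd : 0 ≤ (W + (1 - q) * y) * (W' + (1 - q) * z) - y * z := by nlinarith [mul_le_mul hv hv' hz0 hv0]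
  positivity

/-- **Floor × (`I ≥ 0`)**: `u = (0, X, y, Z, ·)` against any `s = ā(vecB q W' z X' Y' s₀)` with `N^{(ac)}(s) ≥ 0`, `I_a(s) ≥ 0`,
masses `≥ 0` — a sum of non-negative terms; covers floor × roof and, through `crossL_swap`, roof × floor. [folklore] -/
theorem crossL_floor_pos {q r W y X Z W' z X' Y' s0 : ℝ} (hq0 : 0 ≤ q) (hq1 : q ≤ 1) (hr0 : 0 ≤ r) (hr1 : r ≤ 1)
    (hX : 0 ≤ X) (hZ : 0 ≤ Z) (hy0 : 0 ≤ y) (hW : q * y ≤ W) (hX' : 0 ≤ X') (hY' : 0 ≤ Y') (hz0 : 0 ≤ z) (hW' : q * z ≤ W')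
    (hs0 : 0 ≤ s0) (hNac : 0 ≤ masterN q (swapAB (vecB q W' z X' Y' s0))) (hI' : 0 ≤ s0 * (W' - q * z) - (X' + Y') * z) :
    0 ≤ crossL q r (vecB q W y X Z 0) (swapAB (vecB q W' z X' Y' s0)) := by
  have e : crossL q r (vecB q W y X Z 0) (swapAB (vecB q W' z X' Y' s0)) =
      (1 - r) * (Z * W + (1 - q) * (X + Z) * y) * masterN q (swapAB (vecB q W' z X' Y' s0))
      + r * (r + (1 - r) * q) * (s0 * (W' + (1 - q) * z) * X * (W + (1 - q) * y) + (1 - q) * Z * y * z * (s0 + Y')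
          + X * X' * (W + (1 - q) * y) * (W' + (1 - q) * z))
      + (1 - q) * (2 - q) * (r * (1 - r)) * y * (X * (s0 * (W' - q * z) - (X' + Y') * z) + (X + Z) * Y' * z) := by
    simp only [crossL, crossC, vecB, masterN, swapAB, swapBC, conv, kap, jA, hx, hy, hz, V5.total]; ring
  rw [e]
  have hq' := sub_nonneg.2 hq1
  have hr' := sub_nonneg.2 hr1
  have h2q : 0 ≤ 2 - q := by linarith
  have hqy : 0 ≤ q * y := mul_nonneg hq0 hy0
  have hqz : 0 ≤ q * z := mul_nonneg hq0 hz0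
  have hW0 : 0 ≤ W := hqy.trans hW
  have hv0 : 0 ≤ W + (1 - q) * y := by nlinarith
  have hv0' : 0 ≤ W' + (1 - q) * z := by nlinarith
  positivity

/-! ### The ray decomposition -/

/-- **Ray decomposition in the apex-`b` coordinates.**  If the second argument `S` has `N^{(ab)}(S) ≥ 0` and makes every floor point
and every roof point (in every frame `qy < W`) non-negative, then every `vecB q W y X Z u₀` with masses `≥ 0` satisfying `(U_b)` in
coordinates (`I_b·N(w) ≤ W·D(w)` for `w ∈ [0,1]`) is non-negative: `u₀ ∈ [0, u₀^roof]` and `L` is affine in `u₀`. [folklore] -/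
theorem crossL_vecB_nonneg_of_rays {q r : ℝ} (hq0 : 0 < q) (hq1 : q < 1) (hr0 : 0 ≤ r) (hr1 : r ≤ 1) {S : V5}
    (hS : 0 ≤ masterN q (swapBC S))
    (hfloor : ∀ W y X Z : ℝ, 0 ≤ X → 0 ≤ Z → 0 ≤ y → q * y < W → 0 ≤ crossL q r (vecB q W y X Z 0) S)
    (hroof : ∀ W y X Z u0 w : ℝ, q * y < W → 0 ≤ y → 0 ≤ X → 0 ≤ Z → 0 ≤ u0 → 0 ≤ w → w ≤ 1 →
      q * (X - Z) * w ^ 2 + 2 * ((1 - q) * X + Z) * w - (2 - q) * Z = 0 →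
      (u0 * (W - q * y) - (X + Z) * y) * ((1 - q) + q * w * (1 - w)) = W * (w ^ 2 * X + (1 - w) ^ 2 * Z) →
      0 ≤ crossL q r (vecB q W y X Z u0) S)
    {W y X Z u0 : ℝ} (hX : 0 ≤ X) (hZ : 0 ≤ Z) (hu0 : 0 ≤ u0) (hyu : u0 ≤ y) (h1 : 0 ≤ W - q * y - X - Z)
    (hUb : ∀ w : ℝ, 0 ≤ w → w ≤ 1 →
      (u0 * (W - q * y) - (X + Z) * y) * ((1 - q) + q * w * (1 - w)) ≤ W * (w ^ 2 * X + (1 - w) ^ 2 * Z)) :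
    0 ≤ crossL q r (vecB q W y X Z u0) S := by
  have hy0 : 0 ≤ y := hu0.trans hyu
  rcases eq_or_lt_of_le (show q * y ≤ W by linarith) with hW | hW
  · -- degenerate frame: `X = Z = Z_1 = 0`
    have hX0 : X = 0 := by linarith
    have hZ0 : Z = 0 := by linarith
    subst hX0 hZ0 hW
    have e : crossL q r (vecB q (q * y) y 0 0 u0) S = r * (r + (1 - r) * q) * (u0 * y) * masterN q (swapBC S) := by
      simp only [crossL, crossC, vecB, masterN, swapAB, swapBC, conv, kap, jA, hx, hy, hz, V5.total]; ring
    rw [e]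
    have := sub_nonneg.2 hr1
    positivity
  · -- the tight probe from the intermediate value theorem
    obtain ⟨w, ⟨hw0, hw1⟩, hRw⟩ : ∃ w ∈ Set.Icc (0:ℝ) 1,
        (fun w : ℝ => q * (X - Z) * w ^ 2 + 2 * ((1 - q) * X + Z) * w - (2 - q) * Z) w = 0 := by
      have hc : ContinuousOn (fun w : ℝ => q * (X - Z) * w ^ 2 + 2 * ((1 - q) * X + Z) * w - (2 - q) * Z) (Set.Icc 0 1) := by
        fun_prop
      refine intermediate_value_Icc zero_le_one hc ⟨?_, ?_⟩
      · have : 0 ≤ (2 - q) * Z := by nlinarith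
        show q * (X - Z) * 0 ^ 2 + 2 * ((1 - q) * X + Z) * 0 - (2 - q) * Z ≤ 0
        nlinarith
      · have : 0 ≤ (2 - q) * X := by nlinarith
        show 0 ≤ q * (X - Z) * 1 ^ 2 + 2 * ((1 - q) * X + Z) * 1 - (2 - q) * Z
        nlinarith
    have hN : 0 < (1 - q) + q * w * (1 - w) := probeN_pos hq0.le hq1 hw0 hw1
    have hWq : 0 < W - q * y := by linarith
    have hden : (W - q * y) * ((1 - q) + q * w * (1 - w)) ≠ 0 := (mul_pos hWq hN).ne'
    -- the roof value above `(X, Z)`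
    obtain ⟨uR, huR⟩ : ∃ uR : ℝ, uR = ((X + Z) * y * ((1 - q) + q * w * (1 - w)) + W * (w ^ 2 * X + (1 - w) ^ 2 * Z)) /
        ((W - q * y) * ((1 - q) + q * w * (1 - w))) := ⟨_, rfl⟩
    have hmul : uR * ((W - q * y) * ((1 - q) + q * w * (1 - w))) =
        (X + Z) * y * ((1 - q) + q * w * (1 - w)) + W * (w ^ 2 * X + (1 - w) ^ 2 * Z) := by
      rw [huR]; exact div_mul_cancel₀ _ hden
    have hT : (uR * (W - q * y) - (X + Z) * y) * ((1 - q) + q * w * (1 - w)) = W * (w ^ 2 * X + (1 - w) ^ 2 * Z) := by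
      linear_combination hmul
    have hle : u0 ≤ uR := by
      by_contra hc
      have hc := not_le.1 hc
      have h2 : (uR * (W - q * y) - (X + Z) * y) * ((1 - q) + q * w * (1 - w)) <
          (u0 * (W - q * y) - (X + Z) * y) * ((1 - q) + q * w * (1 - w)) :=
        mul_lt_mul_of_pos_right (by nlinarith [mul_lt_mul_of_pos_right hc hWq]) hN
      linarith [hUb w hw0 hw1]
    have huR0 : 0 ≤ uR := hu0.trans hle
    have hfl := hfloor W y X Z hX hZ hy0 hW
    rcases eq_or_lt_of_le huR0 with hR0 | hRpos
    · have hu00 : u0 = 0 := le_antisymm (hR0 ▸ hle) hu0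
      rw [hu00]; exact hfl
    · have hrf := hroof W y X Z uR w hW hy0 hX hZ huR0 hw0 hw1 hRw hT
      have hsplit : u0 = u0 / uR * uR + (1 - u0 / uR) * 0 := by
        rw [mul_zero, add_zero, div_mul_cancel₀ _ hRpos.ne']
      rw [hsplit, crossL_u0_affine]
      have hc1 : u0 / uR ≤ 1 := (div_le_one hRpos).2 hle
      have := sub_nonneg.2 hc1
      exact add_nonneg (mul_nonneg (div_nonneg hu0 huR0) hrf) (mul_nonneg this hfl)

/-- **Ray decomposition for `u ∈ InKE`** (masses `≥ 0` and `(U_b)` come from `InKE.valid`, `InKE.uCondB`). [folklore] -/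
theorem crossL_nonneg_of_rays {q r : ℝ} (hq0 : 0 < q) (hq1 : q < 1) (hr0 : 0 ≤ r) (hr1 : r ≤ 1) {S : V5}
    (hS : 0 ≤ masterN q (swapBC S))
    (hfloor : ∀ W y X Z : ℝ, 0 ≤ X → 0 ≤ Z → 0 ≤ y → q * y < W → 0 ≤ crossL q r (vecB q W y X Z 0) S)
    (hroof : ∀ W y X Z u0 w : ℝ, q * y < W → 0 ≤ y → 0 ≤ X → 0 ≤ Z → 0 ≤ u0 → 0 ≤ w → w ≤ 1 →
      q * (X - Z) * w ^ 2 + 2 * ((1 - q) * X + Z) * w - (2 - q) * Z = 0 →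
      (u0 * (W - q * y) - (X + Z) * y) * ((1 - q) + q * w * (1 - w)) = W * (w ^ 2 * X + (1 - w) ^ 2 * Z) →
      0 ≤ crossL q r (vecB q W y X Z u0) S)
    {u : V5} (hu : InKE q u) : 0 ≤ crossL q r u S := by
  obtain ⟨h0, hab, hac, hbc, h1⟩ := (hu.valid hq0.le hq1.le).nonneg
  have hUb := hu.uCondB hq0 hq1.le
  have key := crossL_vecB_nonneg_of_rays hq0 hq1 hr0 hr1 hS hfloor hroof (W := u.total - (1 - q) * (u.z0 + u.zac))
    (y := u.z0 + u.zac) hab hbc h0 (by linarith) (by simp only [V5.total]; linarith) (by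
      intro w hw0 hw1
      have h := hUb w (1 - w) hw0 (sub_nonneg.2 hw1)
      rw [uForm_eq_wlin] at h
      simp only [wlin, jA_eq, swapAB, V5.total] at h ⊢
      linarith)
  rwa [vecB_eta] at key

/-- **`L ≥ 0` on `InKE × InKE`** (`0 < q < 1`, `r ∈ [0,1]`). [folklore] -/
theorem crossL_nonneg_inKE {q r : ℝ} (hq0 : 0 < q) (hq1 : q < 1) (hr0 : 0 ≤ r) (hr1 : r ≤ 1) {u s : V5}
    (hu : InKE q u) (hs : InKE q s) : 0 ≤ crossL q r u s := by
  have hq1' : q ≤ 1 := hq1.le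
  have hq2 : q < 2 := by linarith
  -- (1) every `v ∈ InKE` against a roof point
  have step1 : ∀ W' z X' Y' s0 w' : ℝ, q * z < W' → 0 ≤ z → 0 ≤ X' → 0 ≤ Y' → 0 ≤ s0 → 0 ≤ w' → w' ≤ 1 →
      q * (X' - Y') * w' ^ 2 + 2 * ((1 - q) * X' + Y') * w' - (2 - q) * Y' = 0 →
      (s0 * (W' - q * z) - (X' + Y') * z) * ((1 - q) + q * w' * (1 - w')) = W' * (w' ^ 2 * X' + (1 - w') ^ 2 * Y') →
      ∀ {v : V5}, InKE q v → 0 ≤ crossL q r v (swapAB (vecB q W' z X' Y' s0)) := by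
    intro W' z X' Y' s0 w' hW' hz0 hX' hY' hs0 hw0' hw1' hR' hT' v hv
    have hN' := probeN_pos hq0.le hq1 hw0' hw1'
    obtain ⟨hNac, hNab, hI'⟩ := roofB_facts hq2 hq0.le hX' hY' hs0 hW'.le hw0' hw1' hN' hR' hT'
    refine crossL_nonneg_of_rays hq0 hq1 hr0 hr1 (by rwa [masterNab_swapAB]) ?_ ?_ hv
    · intro W y X Z hX hZ hy0 hW
      exact crossL_floor_pos hq0.le hq1' hr0 hr1 hX hZ hy0 hW.le hX' hY' hz0 hW'.le hs0 hNac hI'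
    · intro W y X Z u0 w hW hy0 hX hZ hu0 hw0 hw1 hR hT
      exact crossL_roof_roof_nonneg hq0 hq1' hr0 hr1 hW hy0 hX hZ hu0 hw0 hw1 (probeN_pos hq0.le hq1 hw0 hw1) hR hT
        hW' hz0 hX' hY' hs0 hw0' hw1' hN' hR' hT'
  -- (2) every `v ∈ InKE` against a floor point
  have step2 : ∀ W' z X' Y' : ℝ, 0 ≤ X' → 0 ≤ Y' → 0 ≤ z → q * z < W' →
      ∀ {v : V5}, InKE q v → 0 ≤ crossL q r v (swapAB (vecB q W' z X' Y' 0)) := by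
    intro W' z X' Y' hX' hY' hz0 hW' v hv
    have hS : 0 ≤ masterN q (swapBC (swapAB (vecB q W' z X' Y' 0))) := by
      have e : masterN q (swapBC (swapAB (vecB q W' z X' Y' 0))) = X' * (W' + (1 - q) * z) + (1 - q) * z * Y' := by
        simp only [masterN, swapBC, swapAB, vecB]; ring
      rw [e]
      have : 0 ≤ W' + (1 - q) * z := by nlinarith
      have := sub_nonneg.2 hq1'
      positivity
    refine crossL_nonneg_of_rays hq0 hq1 hr0 hr1 hS ?_ ?_ hv
    · intro W y X Z hX hZ hy0 hW
      exact crossL_floor_floor hq0.le hq1' hr0 hr1 hX hZ hy0 hW.le hX' hY' hz0 hW'.le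
    · intro W y X Z u0 w hW hy0 hX hZ hu0 hw0 hw1 hR hT
      obtain ⟨hNbc, -, hI⟩ := roofB_facts hq2 hq0.le hX hZ hu0 hW.le hw0 hw1 (probeN_pos hq0.le hq1 hw0 hw1) hR hT
      rw [crossL_swap, swapAB_swapAB]
      exact crossL_floor_pos hq0.le hq1' hr0 hr1 hX' hY' hz0 hW'.le hX hZ hy0 hW.le hu0 hNbc hI
  -- (3) reduce `s` through the symmetry
  rw [crossL_swap]
  refine crossL_nonneg_of_rays hq0 hq1 hr0 hr1
    (by rw [masterNab_swapAB]; exact (hu.valid hq0.le hq1').nAB) ?_ ?_ hs.swapAB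
  · intro W' z X' Y' hX' hY' hz0 hW'
    rw [crossL_swap, swapAB_swapAB]
    exact step2 W' z X' Y' hX' hY' hz0 hW' hu
  · intro W' z X' Y' s0 w' hW' hz0 hX' hY' hs0 hw0' hw1' hR' hT'
    rw [crossL_swap, swapAB_swapAB]
    exact step1 W' z X' Y' s0 w' hW' hz0 hX' hY' hs0 hw0' hw1' hR' hT' hu

/-- **`L ≥ 0` on `InKE × InKE`**, dot form. [folklore] -/
theorem InKE.crossL_nonneg {q r : ℝ} (hq0 : 0 < q) (hq1 : q < 1) (hr0 : 0 ≤ r) (hr1 : r ≤ 1) {u s : V5}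
    (hu : InKE q u) (hs : InKE q s) : 0 ≤ crossL q r u s :=
  crossL_nonneg_inKE hq0 hq1 hr0 hr1 hu hs

/-- **THE CROSS-APEX ADJACENT RAYLEIGH DIFFERENCE IS `≥ 0` ON `InKE × InKE`** (`0 < q ≤ 1`, `r ∈ [0,1]`):
`Z¹⁰Z⁰¹ − Z¹¹Z⁰⁰ ≥ 0` for `Z^{στ} = val(s ∗ edgeBC(τ) ∗ E_r(edgeAC(σ) ∗ u))`. [folklore] -/
theorem InKE.rayleigh_cross_nonneg {q r : ℝ} (hq0 : 0 < q) (hq1 : q ≤ 1) (hr0 : 0 ≤ r) (hr1 : r ≤ 1) {u s : V5}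
    (hu : InKE q u) (hs : InKE q s) :
    0 ≤ crossZ q r u s 1 0 * crossZ q r u s 0 1 - crossZ q r u s 1 1 * crossZ q r u s 0 0 := by
  rw [crossL_eq]
  rcases eq_or_lt_of_le hq1 with h1 | h1
  · subst h1; simp
  · have := sub_nonneg.2 hq1
    exact mul_nonneg (by positivity) (crossL_nonneg_inKE hq0 h1 hr0 hr1 hu hs)

end ThreeApex

end FK

end Summit.CriticalPhenomena.PercolationContinuityZ3.Theorems
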